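import Literature.AlgebraicGeometry.HodgeTheory.BettiHardLefschetzInequalities
import Literature.AlgebraicGeometry.HodgeTheory.BettiPoincarePolynomial
import HarnessLib

/-!
# The Lefschetz decomposition as a Poincaré-polynomial identity on the lane's Betti numbers: `(1 − t²) · P_X(t) = Σ_{a ≤ n} dim Pᵃ · (tᵃ − t^{2n+2−a})`,
# `P_X(t) = Σ_{a ≤ n} dim Pᵃ · (tᵃ + t^{a+2} + ⋯ + t^{2n−a})`, `Σ_k b_k = Σ_{a ≤ n} (n + 1 − a) · dim Pᵃ`, `E(X) = Σ_{a ≤ n} (−1)ᵃ (n + 1 − a) · dim Pᵃ`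
# (Voisin I Thm. 6.25 / Cor. 6.26; Arapura Thm. 14.1.1 / Cor. 14.1.2; Hatcher §3.2 Ex. 15, Cor. 3.37)

Family `hodge`, lane `lit-hodgefound` (Track 2 foundations library; Layers A1/A4), layer `Literature/AlgebraicGeometry/HodgeTheory`.  THEOREMS ONLY (no definition,
no named fact, no instance; D-0026 net debt `0`).  Sequel of the seat's g26-#1 (`BettiHardLefschetzInequalities`: the primitive Betti numbers `dim_ℚ Pᵃ = b_a − b_{a−2}` (`2 ≤ a ≤ n`),
`= b_a` (`a ≤ 1`), `= 0` (`a > n`) for any class `κ ∈ H²(X(ℂ); ℚ)` with the hard Lefschetz property) and of g25's `BettiPoincarePolynomial` (the lane's Poincaré polynomial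
`P_X(t) = Σ_{i ≤ 2n} b_i(X) tⁱ ∈ ℤ[t]`, spelled inline as `∑ i ∈ range (2n+1), C (b_i : ℤ) * X ^ i`; `[tᵏ] P = b_k`, palindromy `b_k = b_{2n−k}`).  The Lefschetz decomposition
`Hᵏ(X, ℚ) = ⨁_{a + 2j = k, a + j ≤ n} Lʲ Pᵃ` (Voisin I Cor. 6.26; Arapura Thm. 14.1.1 «`Hⁱ(X, ℂ) = ⨁_{j} Lʲ P^{i−2j}(X)`») says that each primitive piece `Pᵃ`, `a ≤ n`, contributes the
«Lefschetz string» `Pᵃ, L Pᵃ, …, L^{n−a} Pᵃ` in degrees `a, a + 2, …, 2n − a`; on generating functions this is the second identity of the title, equivalently (multiply by `1 − t²`) the first,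
whose coefficients are `b_k − b_{k−2} = dim Pᵏ` below the middle and `= −dim P^{2n+2−k}` above it (palindromy).  At `t = 1` and `t = −1`: the total Betti number and the Euler
characteristic as weighted counts of primitive classes.

THE PRINTS.  C. Voisin (2002) [VoisinHodgeI2002] §6.2.3 Thm. 6.25, Cor. 6.26 (PDF p0125–0126: the Lefschetz decomposition `Hᵏ(X, ℝ) = ⨁_{2r ≤ k} Lʳ H^{k−2r}_prim`), Rem. 6.27.  D. Arapura (2012)
[Arapura2012] §14.1 Thm. 14.1.1, Cor. 14.1.2 (PDF p0212: «the Betti numbers `b_{i−2} ≤ b_i` for `i ≤ dim X / 2`»).  A. Hatcher (2002) [HatcherAT2002] §3.2 Exercise 15 (held text p0296: the Poincaré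
series / polynomial `p(t) = Σ_i (dim Hⁱ) tⁱ`), §3.3 Cor. 3.37 (Poincaré duality).

WHAT IS PROVED (for `X` smooth projective of dimension `n` over `ℂ`, `κ ∈ H²(X(ℂ); ℚ)` with `HasHardLefschetzProperty κ n` — e.g. the rational Kähler class `D.η` of a Kähler–rational datum,
`KaehlerRationalDatum.hasHardLefschetzProperty_rat`; `Pᵃ = primitiveClasses κ n a`).
* **`BettiUniverse.one_sub_X_sq_mul_poincarePoly`** — `(1 − t²) · P_X(t) = Σ_{a ≤ n} dim Pᵃ · (tᵃ − t^{2n+2−a})` in `ℤ[t]`.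
* **`BettiUniverse.poincarePoly_eq_sum_finrank_primitiveClasses_mul`** — `P_X(t) = Σ_{a ≤ n} dim Pᵃ · Σ_{j ≤ n−a} t^{a+2j}` (the Lefschetz strings).
* **`BettiUniverse.sum_finrank_bettiCohomology_eq_sum_primitive`** — `Σ_{k ≤ 2n} b_k = Σ_{a ≤ n} (n + 1 − a) · dim Pᵃ`; **`BettiUniverse.eulerChar_eq_sum_primitive`** —
  `Σ_{k ≤ 2n} (−1)ᵏ b_k = Σ_{a ≤ n} (−1)ᵃ (n + 1 − a) · dim Pᵃ`.
* `KaehlerRationalDatum.poincarePoly_eq_sum_finrank_primitiveClasses_mul` — the same for the rational Kähler class of a Kähler–rational datum (exists on every smooth projective `X`).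

DEVIATIONS / SCOPE.  Pure dimension bookkeeping on the lane's `ℚ`-Betti numbers; no statement about Hodge numbers (those are g26-#2) and none about the pieces themselves beyond g26-#1.

## References
* [VoisinHodgeI2002] C. Voisin, *Hodge Theory and Complex Algebraic Geometry I* (2002) — §6.2.3 Thm. 6.25, Cor. 6.26, Rem. 6.27 (PDF pp. 125–126).
* [Arapura2012] D. Arapura, *Algebraic Geometry over the Complex Numbers* (2012) — §14.1 Thm. 14.1.1, Cor. 14.1.2 (PDF p. 212).
* [HatcherAT2002] A. Hatcher, *Algebraic Topology* (2002) — §3.2 Exercise 15 (p. 296 of the held text), §3.3 Cor. 3.37.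

## Provenance
Lane `lit-hodgefound` (Hodge path, Track 2), prover seat `lit-hodgefound-p29` (generation 26), self-proposed row g26-#8 (sequel of g26-#1 and g25's Poincaré polynomial file).
-/

noncomputable section

open CategoryTheory Module Finset
open Polynomial (C)
open Literature.AlgebraicTopology.SingularHomology
open Literature.Geometry.Kaehler

namespace Literature.AlgebraicGeometry.HodgeTheory

open Literature.AlgebraicGeometry.Motives
open Literature.AlgebraicGeometry.Motives.HodgeStructure

variable {n : ℕ} {X : SchemeOver ℂ}

/-! ### Coefficient bookkeeping -/

/-- `[tᵏ] ((1 − t²) · P) = [tᵏ] P − [t^{k−2}] P` (the latter `0` for `k < 2`). [folklore] -/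
private theorem coeff_one_sub_X_sq_mul (P : Polynomial ℤ) (k : ℕ) :
    ((1 - Polynomial.X ^ 2) * P).coeff k = P.coeff k - if 2 ≤ k then P.coeff (k - 2) else 0 := by
  rw [sub_mul, one_mul, Polynomial.coeff_sub, Polynomial.coeff_X_pow_mul']

/-- `[tᵏ] Σ_{a ≤ n} f(a) (tᵃ − t^{2n+2−a}) = [k ≤ n] f(k) − [n + 2 ≤ k ≤ 2n + 2] f(2n + 2 − k)`. [folklore] -/
private theorem coeff_sum_C_mul_X_pow_sub (f : ℕ → ℤ) (n k : ℕ) :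
    (∑ a ∈ range (n + 1), C (f a) * (Polynomial.X ^ a - Polynomial.X ^ (2 * n + 2 - a))).coeff k =
      (if k ≤ n then f k else 0) - (if n + 2 ≤ k ∧ k ≤ 2 * n + 2 then f (2 * n + 2 - k) else 0) := by
  rw [Polynomial.finsetSum_coeff]
  simp_rw [Polynomial.coeff_C_mul, Polynomial.coeff_sub, Polynomial.coeff_X_pow, mul_sub]
  rw [Finset.sum_sub_distrib]
  congr 1
  · simp_rw [mul_ite, mul_one, mul_zero]
    rw [Finset.sum_ite_eq (range (n + 1)) k f]
    by_cases hk : k ≤ n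
    · rw [if_pos (Finset.mem_range.2 (by omega)), if_pos hk]
    · rw [if_neg (fun h ↦ hk (by rw [Finset.mem_range] at h; omega)), if_neg hk]
  · simp_rw [mul_ite, mul_one, mul_zero]
    by_cases h : n + 2 ≤ k ∧ k ≤ 2 * n + 2
    · rw [if_pos h, Finset.sum_eq_single_of_mem (2 * n + 2 - k) (Finset.mem_range.2 (by omega))]
      · rw [if_pos (by omega)]
      · intro a ha hne
        rw [if_neg]
        intro hk
        exact hne (by omega)
    · rw [if_neg h]
      refine Finset.sum_eq_zero fun a ha ↦ ?_
      rw [Finset.mem_range] at ha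
      rw [if_neg]
      omega

/-! ### §1 `(1 − t²) · P_X(t) = Σ_{a ≤ n} dim Pᵃ · (tᵃ − t^{2n+2−a})` -/

/-- **`(1 − t²) · P_X(t) = Σ_{a ≤ n} dim_ℚ Pᵃ · (tᵃ − t^{2n+2−a})`** in `ℤ[t]`, for any class `κ ∈ H²(X(ℂ); ℚ)` with the hard Lefschetz property: coefficientwise, `b_k − b_{k−2} = dim Pᵏ` for
`k ≤ n` (g26-#1 `finrank_primitiveClasses_eq_sub`, `…_of_le_one`), `b_{n+1} = b_{n−1}`, and `b_k − b_{k−2} = b_{2n−k} − b_{2n+2−k} = −dim P^{2n+2−k}` for `n + 2 ≤ k ≤ 2n + 2` (Poincaré duality).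
[cite: VoisinHodgeI2002, §6.2.3 Thm. 6.25 and Cor. 6.26] [cite: Arapura2012, §14.1 Thm. 14.1.1 and Cor. 14.1.2 (PDF p. 212)] [cite: HatcherAT2002, §3.3 Cor. 3.37] -/
theorem BettiUniverse.one_sub_X_sq_mul_poincarePoly (hX : IsSmoothProjective n X) (κ : bettiCohomology X 2) (hL : HasHardLefschetzProperty κ n) :
    (1 - Polynomial.X ^ 2) * (∑ i ∈ range (2 * n + 1), C (Module.finrank ℚ (bettiCohomology X i) : ℤ) * Polynomial.X ^ i) =
      ∑ a ∈ range (n + 1), C (Module.finrank ℚ (primitiveClasses κ n a) : ℤ) * (Polynomial.X ^ a - Polynomial.X ^ (2 * n + 2 - a)) := by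
  refine Polynomial.ext fun k ↦ ?_
  rw [coeff_one_sub_X_sq_mul, coeff_sum_C_mul_X_pow_sub, BettiUniverse.coeff_poincarePoly hX k]
  -- names for the Betti numbers that occur
  have hvan : ∀ i, 2 * n < i → (Module.finrank ℚ (bettiCohomology X i) : ℤ) = 0 := fun i hi ↦ by
    rw [BettiUniverse.finrank_bettiCohomology_eq_zero_of_lt hX hi, Nat.cast_zero]
  have hpd : ∀ i j, i + j = 2 * n → (Module.finrank ℚ (bettiCohomology X i) : ℤ) = Module.finrank ℚ (bettiCohomology X j) := fun i j h ↦ by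
    rw [BettiUniverse.finrank_bettiCohomology_eq_of_add_eq hX h]
  have hlow : ∀ a, a ≤ 1 → a ≤ n → (Module.finrank ℚ (primitiveClasses κ n a) : ℤ) = Module.finrank ℚ (bettiCohomology X a) := fun a h1 hn ↦ by
    rw [BettiUniverse.finrank_primitiveClasses_of_le_one κ hX h1 hn]
  have hsub : ∀ a, 2 ≤ a → a ≤ n →
      (Module.finrank ℚ (primitiveClasses κ n a) : ℤ) = Module.finrank ℚ (bettiCohomology X a) - Module.finrank ℚ (bettiCohomology X (a - 2)) :=
    fun a h2 ha ↦ BettiUniverse.finrank_primitiveClasses_eq_sub hX hL h2 ha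
  rcases Nat.lt_or_ge k 2 with hk2 | hk2
  · -- `k ≤ 1`: no `t^{k−2}` term, and `k < n + 2`
    rw [if_neg (show ¬(2 ≤ k) by omega), sub_zero, if_neg (show ¬(n + 2 ≤ k ∧ k ≤ 2 * n + 2) by omega), sub_zero]
    rcases le_or_gt k n with hkn | hkn
    · rw [if_pos hkn, hlow k (by omega) hkn]
    · -- `n < k ≤ 1`: `n = 0`, `k = 1`, `b_1 = 0`
      rw [if_neg (show ¬(k ≤ n) by omega)]
      exact hvan k (by omega)
  · rw [if_pos hk2, BettiUniverse.coeff_poincarePoly hX (k - 2)]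
    rcases le_or_gt k n with hkn | hkn
    · -- below the middle
      rw [if_pos hkn, if_neg (show ¬(n + 2 ≤ k ∧ k ≤ 2 * n + 2) by omega), sub_zero, hsub k hk2 hkn]
    · rw [if_neg (show ¬(k ≤ n) by omega), zero_sub]
      rcases Nat.lt_or_ge k (n + 2) with hk' | hk'
      · -- `k = n + 1`: `b_{n+1} = b_{n−1}`
        rw [if_neg (show ¬(n + 2 ≤ k ∧ k ≤ 2 * n + 2) by omega), neg_zero, hpd k (k - 2) (by omega), sub_self]
      · rcases le_or_gt k (2 * n + 2) with hk'' | hk''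
        · rw [if_pos ⟨hk', hk''⟩]
          rcases le_or_gt (2 * n + 2 - k) 1 with ha1 | ha1
          · -- `a = 2n + 2 − k ≤ 1`, i.e. `k ∈ {2n+1, 2n+2}`
            rw [hlow _ ha1 (by omega), hvan k (by omega), zero_sub, hpd (k - 2) (2 * n + 2 - k) (by omega)]
          · rw [hsub _ (by omega) (by omega), hpd k (2 * n + 2 - k - 2) (by omega), hpd (k - 2) (2 * n + 2 - k) (by omega)]
            ring
        · -- `k > 2n + 2`: everything vanishes
          rw [if_neg (show ¬(n + 2 ≤ k ∧ k ≤ 2 * n + 2) by omega), neg_zero, hvan k (by omega), hvan (k - 2) (by omega), sub_self]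

/-! ### §2 `P_X(t) = Σ_{a ≤ n} dim Pᵃ · (tᵃ + t^{a+2} + ⋯ + t^{2n−a})`: the Lefschetz strings -/

/-- **`P_X(t) = Σ_{a ≤ n} dim_ℚ Pᵃ · Σ_{j ≤ n−a} t^{a+2j}`**: the Poincaré polynomial is the sum over the primitive pieces `Pᵃ` (`a ≤ n`) of `dim Pᵃ` times the generating function
`tᵃ + t^{a+2} + ⋯ + t^{2n−a}` of the Lefschetz string `Pᵃ, L Pᵃ, …, L^{n−a} Pᵃ` («`Hⁱ(X, ℂ) = ⨁_j Lʲ P^{i−2j}(X)`», `Lʲ` injective on `Pᵃ` for `a + j ≤ n`). From §1, dividing by `1 − t²` in the domain `ℤ[t]`.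
[cite: VoisinHodgeI2002, §6.2.3 Thm. 6.25 and Cor. 6.26] [cite: Arapura2012, §14.1 Thm. 14.1.1 (PDF p. 212)] [cite: HatcherAT2002, §3.2 Exercise 15] -/
theorem BettiUniverse.poincarePoly_eq_sum_finrank_primitiveClasses_mul (hX : IsSmoothProjective n X) (κ : bettiCohomology X 2) (hL : HasHardLefschetzProperty κ n) :
    (∑ i ∈ range (2 * n + 1), C (Module.finrank ℚ (bettiCohomology X i) : ℤ) * Polynomial.X ^ i) =
      ∑ a ∈ range (n + 1), C (Module.finrank ℚ (primitiveClasses κ n a) : ℤ) * ∑ j ∈ range (n - a + 1), Polynomial.X ^ (a + 2 * j) := by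
  have hne : (1 - Polynomial.X ^ 2 : Polynomial ℤ) ≠ 0 := by
    intro h
    have h0 := congrArg (fun q : Polynomial ℤ ↦ q.coeff 0) h
    simp only [Polynomial.coeff_sub, Polynomial.coeff_one_zero, Polynomial.coeff_X_pow, Polynomial.coeff_zero] at h0
    norm_num at h0
  refine mul_left_cancel₀ hne ?_
  rw [BettiUniverse.one_sub_X_sq_mul_poincarePoly hX κ hL, Finset.mul_sum]
  refine Finset.sum_congr rfl fun a ha ↦ ?_
  rw [Finset.mem_range] at ha
  rw [mul_left_comm]
  congr 1
  have hgeom : ∑ j ∈ range (n - a + 1), (Polynomial.X : Polynomial ℤ) ^ (a + 2 * j) = Polynomial.X ^ a * ∑ j ∈ range (n - a + 1), (Polynomial.X ^ 2) ^ j := by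
    rw [Finset.mul_sum]
    exact Finset.sum_congr rfl fun j _ ↦ by rw [pow_add, pow_mul]
  rw [hgeom, mul_left_comm, mul_neg_geom_sum, mul_sub, mul_one, ← pow_mul, ← pow_add,
    show a + 2 * (n - a + 1) = 2 * n + 2 - a by omega]

/-! ### §3 At `t = 1` and `t = −1`: total Betti number and Euler characteristic by primitive pieces -/

/-- **`Σ_{k ≤ 2n} b_k(X) = Σ_{a ≤ n} (n + 1 − a) · dim_ℚ Pᵃ`**: the total Betti number counts each primitive class with the length `n − a + 1` of its Lefschetz string (§2 at `t = 1`).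
[cite: VoisinHodgeI2002, §6.2.3 Cor. 6.26] [cite: Arapura2012, §14.1 Thm. 14.1.1 (PDF p. 212)] -/
theorem BettiUniverse.sum_finrank_bettiCohomology_eq_sum_primitive (hX : IsSmoothProjective n X) (κ : bettiCohomology X 2) (hL : HasHardLefschetzProperty κ n) :
    ∑ k ∈ range (2 * n + 1), (Module.finrank ℚ (bettiCohomology X k) : ℤ) =
      ∑ a ∈ range (n + 1), ((n - a + 1 : ℕ) : ℤ) * (Module.finrank ℚ (primitiveClasses κ n a) : ℤ) := by
  have h := congrArg (Polynomial.eval (1 : ℤ)) (BettiUniverse.poincarePoly_eq_sum_finrank_primitiveClasses_mul hX κ hL)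
  simp only [Polynomial.eval_finsetSum, Polynomial.eval_mul, Polynomial.eval_C, Polynomial.eval_pow, Polynomial.eval_X, one_pow, mul_one,
    Finset.sum_const, Finset.card_range] at h
  rw [h]
  exact Finset.sum_congr rfl fun a _ ↦ by push_cast; ring

/-- **`E(X) = Σ_{k ≤ 2n} (−1)ᵏ b_k(X) = Σ_{a ≤ n} (−1)ᵃ (n + 1 − a) · dim_ℚ Pᵃ`** (§2 at `t = −1`: a Lefschetz string lives in degrees of one parity). [cite: VoisinHodgeI2002, §6.2.3 Cor. 6.26]
[cite: HatcherAT2002, §3.2 Exercise 15 and §3.3 Cor. 3.37] -/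
theorem BettiUniverse.eulerChar_eq_sum_primitive (hX : IsSmoothProjective n X) (κ : bettiCohomology X 2) (hL : HasHardLefschetzProperty κ n) :
    ∑ k ∈ range (2 * n + 1), (-1 : ℤ) ^ k * (Module.finrank ℚ (bettiCohomology X k) : ℤ) =
      ∑ a ∈ range (n + 1), (-1 : ℤ) ^ a * ((n - a + 1 : ℕ) : ℤ) * (Module.finrank ℚ (primitiveClasses κ n a) : ℤ) := by
  have h := congrArg (Polynomial.eval (-1 : ℤ)) (BettiUniverse.poincarePoly_eq_sum_finrank_primitiveClasses_mul hX κ hL)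
  rw [BettiUniverse.poincarePoly_eval_neg_one n X] at h
  rw [h, Polynomial.eval_finsetSum]
  refine Finset.sum_congr rfl fun a _ ↦ ?_
  rw [Polynomial.eval_mul, Polynomial.eval_C, Polynomial.eval_finsetSum]
  have hj : ∀ j ∈ range (n - a + 1), Polynomial.eval (-1 : ℤ) (Polynomial.X ^ (a + 2 * j)) = (-1) ^ a := fun j _ ↦ by
    rw [Polynomial.eval_pow, Polynomial.eval_X, pow_add, pow_mul, neg_one_sq, one_pow, mul_one]
  rw [Finset.sum_congr rfl hj, Finset.sum_const, Finset.card_range, nsmul_eq_mul]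
  push_cast
  ring

/-! ### §4 For the rational Kähler class of a Kähler–rational datum (exists on every smooth projective `X`) -/

namespace KaehlerRationalDatum

variable (D : KaehlerRationalDatum n X)

/-- **`P_X(t) = Σ_{a ≤ n} dim_ℚ Pᵃ_η · Σ_{j ≤ n−a} t^{a+2j}`** for the primitive cohomology of the rational Kähler class `η` of a Kähler–rational datum. [cite: VoisinHodgeI2002, §6.2.3 Thm. 6.25 and Cor. 6.26]
[cite: Arapura2012, §14.1 Thm. 14.1.1 (PDF p. 212)] -/
theorem poincarePoly_eq_sum_finrank_primitiveClasses_mul (hX : IsSmoothProjective n X) :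
    (∑ i ∈ range (2 * n + 1), C (Module.finrank ℚ (bettiCohomology X i) : ℤ) * Polynomial.X ^ i) =
      ∑ a ∈ range (n + 1), C (Module.finrank ℚ (primitiveClasses D.η n a) : ℤ) * ∑ j ∈ range (n - a + 1), Polynomial.X ^ (a + 2 * j) :=
  BettiUniverse.poincarePoly_eq_sum_finrank_primitiveClasses_mul hX D.η (D.hasHardLefschetzProperty_rat hX)

/-- **`(1 − t²) · P_X(t) = Σ_{a ≤ n} dim_ℚ Pᵃ_η · (tᵃ − t^{2n+2−a})`** for the rational Kähler class. [cite: VoisinHodgeI2002, §6.2.3 Thm. 6.25 and Cor. 6.26] -/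
theorem one_sub_X_sq_mul_poincarePoly (hX : IsSmoothProjective n X) :
    (1 - Polynomial.X ^ 2) * (∑ i ∈ range (2 * n + 1), C (Module.finrank ℚ (bettiCohomology X i) : ℤ) * Polynomial.X ^ i) =
      ∑ a ∈ range (n + 1), C (Module.finrank ℚ (primitiveClasses D.η n a) : ℤ) * (Polynomial.X ^ a - Polynomial.X ^ (2 * n + 2 - a)) :=
  BettiUniverse.one_sub_X_sq_mul_poincarePoly hX D.η (D.hasHardLefschetzProperty_rat hX)

/-- **`Σ_k b_k(X) = Σ_{a ≤ n} (n + 1 − a) · dim_ℚ Pᵃ_η`.** [cite: VoisinHodgeI2002, §6.2.3 Cor. 6.26] -/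
theorem sum_finrank_bettiCohomology_eq_sum_primitive (hX : IsSmoothProjective n X) :
    ∑ k ∈ range (2 * n + 1), (Module.finrank ℚ (bettiCohomology X k) : ℤ) =
      ∑ a ∈ range (n + 1), ((n - a + 1 : ℕ) : ℤ) * (Module.finrank ℚ (primitiveClasses D.η n a) : ℤ) :=
  BettiUniverse.sum_finrank_bettiCohomology_eq_sum_primitive hX D.η (D.hasHardLefschetzProperty_rat hX)

end KaehlerRationalDatum

end Literature.AlgebraicGeometry.HodgeTheory

end
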